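import Mathlib
import Summits.CriticalPhenomena.CardyFormulaZ2.Theorems.CardySelfRefinementGradientComparabilityKernelsDictionary
import Summits.CriticalPhenomena.CardyFormulaZ2.Theorems.CardySelfRefinementGradientComparabilityStubLevelCurveIFT
import HarnessLib

/-!
# `GradientComparability`, line `Sketch`: the finite-size level curves, UNCONDITIONALLY

Route `CardySelfRefinement`, sub-problem `CriticalPhenomena/CardyFormulaZ2`; crux `GradientComparability`
(stmt-CriticalPhenomena-10269), line `Sketch` (card `Ideas/level-curve-window-transport.md`).
Vocabulary (`M A P Dρ Dc PathOK`, …) from `CardySelfRefinementDefs` (definitionally the route's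
`let`-chain).

`levelCurvesAlongPath` (file `…KernelsBulk`) bundles the two level curves of the crossing polynomial
`P_η(ρ,·)` with Kesten's dictionary at the path points, and is therefore CONDITIONAL on the two
research kernels (W) and (R).  This file extracts the unconditional part, which is all a consumer of
"finite-size critical curves" needs and which is PROVED from landed inputs only
(`stub_boundaryValues`, `stub_Dc_pos_of_nonconstant`, `stub_levelCurve_IFT`, `exists_contDiff_eq_P`,
`P_mono_c`):

* `levelCurves_unconditional` — for `k ∈ {2,3}`, every nonempty quad family, every depth
  `δ ∈ (0,½]`, two levels `0 < vlo < vhi < 1` and every small mesh `η`: two functions `cm < cp` on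
  `[0, 1−δ]` with values in `[0,1]`, `P_η(ρ, cm ρ) = vlo`, `P_η(ρ, cp ρ) = vhi`, each solving the
  level-curve ODE `c' = −∂ρP/∂cP` within `[0, 1−δ]` (so each is `C¹` there), with `∂cP > 0` on the
  band `{vlo ≤ P_η(ρ,·) ≤ vhi}`, and the band at height `ρ` is EXACTLY the segment `[cm ρ, cp ρ]`.

No RSW input is used: the statement holds for every `γ` (the `PathOK` hypothesis is carried only to
match the line's signatures) — the finite-size window of `P_η(ρ,·)` exists for every `ρ ≤ 1 − δ`
because `P_η(ρ,0) → 0`-side values stay below `vlo` (subcritical coarse lattice, `P_zero_lt_eventually`)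
and `P_η(ρ,1) = 1` eventually (deterministic open rows, `P_one_eq_one_eventually`).
-/

noncomputable section

namespace Summit.CriticalPhenomena.CardyFormulaZ2.Theorems.CardySelfRefinement

open scoped Topology
open Filter Set MeasureTheory
open Literature.Probability.LatticeModels Literature.Probability.Percolation
open Literature.Probability.Percolation.QuadCrossing
open Summit.CriticalPhenomena.CardyFormulaZ2.Theses.CardySelfRefinement

/-- **The finite-size level curves of the crossing polynomial (unconditional).**  For `k ∈ {2,3}`, a
nonempty quad family `F`, a depth `δ ∈ (0,½]` and two levels `0 < vlo < vhi < 1`, for every small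
mesh `η` there are two level curves `cm < cp : [0, 1−δ] → [0,1]` of `P_η(ρ,·)` at the levels
`vlo`, `vhi`, each with derivative `−∂ρP/∂cP` within `[0, 1−δ]` (implicit function theorem), the
Russo derivative `∂cP` is positive on the band `{vlo ≤ P_η(ρ,·) ≤ vhi}`, and that band is exactly
`[cm ρ, cp ρ]`.  Inputs: boundary values (`stub_boundaryValues`), positivity of `∂cP` at interior
non-constant points (`stub_Dc_pos_of_nonconstant`), the polynomial structure of `P`
(`exists_contDiff_eq_P`, `derivWithin_eq_fderiv_fst/snd`), monotonicity in `c` (`P_mono_c`) and the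
level-curve IFT (`stub_levelCurve_IFT`). -/
theorem levelCurves_unconditional :
    ∀ k : ℕ, k = 2 ∨ k = 3 → ∀ γ : unitInterval → ℝ × ℝ, PathOK k γ →
      ∀ (m : ℕ) (F : Fin m → Quad (Set.univ : Set ℂ)), 0 < m → ∀ δ : ℝ, 0 < δ → δ ≤ 1 / 2 →
        ∀ vlo vhi : ℝ, 0 < vlo → vlo < vhi → vhi < 1 →
          ∃ η₁ : ℝ, 0 < η₁ ∧ ∀ η ∈ Set.Ioo 0 η₁, ∃ cm cp : ℝ → ℝ,
            (∀ ρ ∈ Set.Icc (0 : ℝ) (1 - δ), cm ρ ∈ Set.Icc (0 : ℝ) 1 ∧ cp ρ ∈ Set.Icc (0 : ℝ) 1 ∧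
                cm ρ < cp ρ ∧ P k m F η ρ (cm ρ) = vlo ∧ P k m F η ρ (cp ρ) = vhi) ∧
            (∀ ρ ∈ Set.Icc (0 : ℝ) (1 - δ), HasDerivWithinAt cp
                (-(Dρ k m F η (ρ, cp ρ) / Dc k m F η (ρ, cp ρ))) (Set.Icc 0 (1 - δ)) ρ) ∧
            (∀ ρ ∈ Set.Icc (0 : ℝ) (1 - δ), HasDerivWithinAt cm
                (-(Dρ k m F η (ρ, cm ρ) / Dc k m F η (ρ, cm ρ))) (Set.Icc 0 (1 - δ)) ρ) ∧
            (∀ ρ ∈ Set.Icc (0 : ℝ) (1 - δ), ∀ c ∈ Set.Icc (0 : ℝ) 1,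
                P k m F η ρ c ∈ Set.Icc vlo vhi → 0 < Dc k m F η (ρ, c)) ∧
            (∀ ρ ∈ Set.Icc (0 : ℝ) (1 - δ), ∀ c ∈ Set.Icc (0 : ℝ) 1,
                (P k m F η ρ c ∈ Set.Icc vlo vhi ↔ cm ρ ≤ c ∧ c ≤ cp ρ)) := by
  intro k hk γ hγ m F hm δ hδ hδ' vlo vhi hvlo hvv hvhi
  obtain ⟨η₁, hη₁, hBV⟩ := stub_boundaryValues k hk γ hγ m F hm δ hδ hδ' vlo vhi hvlo hvv hvhi
  refine ⟨η₁, hη₁, fun η hη => ?_⟩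
  have hη0 : η ≠ 0 := hη.1.ne'
  have hBVη := hBV η hη
  -- positivity of `∂cP` on the band (the band lies in the open interval `0 < c < 1`)
  have hPOS : ∀ ρ ∈ Set.Icc (0 : ℝ) (1 - δ), ∀ c ∈ Set.Icc (0 : ℝ) 1,
      P k m F η ρ c ∈ Set.Icc vlo vhi → 0 < Dc k m F η (ρ, c) := by
    intro ρ hρ c hc hband
    obtain ⟨h0, h1⟩ := hBVη ρ hρ
    have hρ01 : ρ ∈ Set.Icc (0 : ℝ) 1 := ⟨hρ.1, by linarith [hρ.2]⟩
    have hc0 : c ≠ 0 := by rintro rfl; linarith [hband.1]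
    have hc1 : c ≠ 1 := by rintro rfl; linarith [hband.2]
    have hcI : c ∈ Set.Ioo (0 : ℝ) 1 := ⟨lt_of_le_of_ne hc.1 (Ne.symm hc0), lt_of_le_of_ne hc.2 hc1⟩
    refine stub_Dc_pos_of_nonconstant k m F hη0 hρ01 hcI ?_
    intro hconst
    have := hconst 0 ⟨le_rfl, zero_le_one⟩
    linarith [hband.1]
  -- the polynomial `Φ` agreeing with `P` on the square, and its partials
  obtain ⟨Φ, hΦ, hPΦ⟩ := exists_contDiff_eq_P k m F hη0
  have hΦd : Differentiable ℝ Φ := hΦ.differentiable (by norm_num)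
  have hDρ : ∀ ρ ∈ Set.Icc (0 : ℝ) 1, ∀ c ∈ Set.Icc (0 : ℝ) 1,
      Dρ k m F η (ρ, c) = fderiv ℝ Φ (ρ, c) (1, 0) := fun ρ hρ c hc =>
    derivWithin_eq_fderiv_fst (hΦd (ρ, c)) hρ (fun ρ' hρ' => hPΦ ρ' hρ' c hc)
  have hDc : ∀ ρ ∈ Set.Icc (0 : ℝ) 1, ∀ c ∈ Set.Icc (0 : ℝ) 1,
      Dc k m F η (ρ, c) = fderiv ℝ Φ (ρ, c) (0, 1) := fun ρ hρ c hc =>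
    derivWithin_eq_fderiv_snd (hΦd (ρ, c)) hc (fun c' hc' => hPΦ ρ hρ c' hc')
  have hI : ∀ ρ ∈ Set.Icc (0 : ℝ) (1 - δ), ρ ∈ Set.Icc (0 : ℝ) 1 :=
    fun ρ hρ => ⟨hρ.1, by linarith [hρ.2]⟩
  have h0 : (0 : ℝ) ∈ Set.Icc (0 : ℝ) 1 := ⟨le_rfl, zero_le_one⟩
  have h1 : (1 : ℝ) ∈ Set.Icc (0 : ℝ) 1 := ⟨zero_le_one, le_rfl⟩
  -- hypotheses of the implicit function theorem for `Φ` at the two levels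
  have hmonoΦ : ∀ ρ ∈ Set.Icc (0 : ℝ) (1 - δ), MonotoneOn (fun c => Φ (ρ, c)) (Set.Icc 0 1) := by
    intro ρ hρ c hc c' hc' hcc'
    show Φ (ρ, c) ≤ Φ (ρ, c')
    rw [← hPΦ ρ (hI ρ hρ) c hc, ← hPΦ ρ (hI ρ hρ) c' hc']
    exact P_mono_c k m F hη0 ρ hcc'
  have hbv : ∀ v : ℝ, vlo ≤ v → v ≤ vhi →
      ∀ ρ ∈ Set.Icc (0 : ℝ) (1 - δ), Φ (ρ, 0) < v ∧ v < Φ (ρ, 1) := by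
    intro v hv1 hv2 ρ hρ
    rw [← hPΦ ρ (hI ρ hρ) 0 h0, ← hPΦ ρ (hI ρ hρ) 1 h1]
    exact ⟨lt_of_lt_of_le (hBVη ρ hρ).1 hv1, lt_of_le_of_lt hv2 (hBVη ρ hρ).2⟩
  have hposΦ : ∀ v : ℝ, vlo ≤ v → v ≤ vhi → ∀ ρ ∈ Set.Icc (0 : ℝ) (1 - δ),
      ∀ c ∈ Set.Icc (0 : ℝ) 1, Φ (ρ, c) = v → 0 < fderiv ℝ Φ (ρ, c) (0, 1) := by
    intro v hv1 hv2 ρ hρ c hc hcv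
    rw [← hDc ρ (hI ρ hρ) c hc]
    refine hPOS ρ hρ c hc ?_
    rw [hPΦ ρ (hI ρ hρ) c hc, hcv]
    exact ⟨hv1, hv2⟩
  obtain ⟨cm, hcm, hcm'⟩ := stub_levelCurve_IFT Φ hΦ 0 (1 - δ) vlo (hbv vlo le_rfl hvv.le) hmonoΦ
    (hposΦ vlo le_rfl hvv.le)
  obtain ⟨cp, hcp, hcp'⟩ := stub_levelCurve_IFT Φ hΦ 0 (1 - δ) vhi (hbv vhi hvv.le le_rfl) hmonoΦ
    (hposΦ vhi hvv.le le_rfl)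
  have hcm01 : ∀ ρ ∈ Set.Icc (0 : ℝ) (1 - δ), cm ρ ∈ Set.Icc (0 : ℝ) 1 := fun ρ hρ =>
    ⟨(hcm ρ hρ).1.1.le, (hcm ρ hρ).1.2.le⟩
  have hcp01 : ∀ ρ ∈ Set.Icc (0 : ℝ) (1 - δ), cp ρ ∈ Set.Icc (0 : ℝ) 1 := fun ρ hρ =>
    ⟨(hcp ρ hρ).1.1.le, (hcp ρ hρ).1.2.le⟩
  have hPm : ∀ ρ ∈ Set.Icc (0 : ℝ) (1 - δ), P k m F η ρ (cm ρ) = vlo := fun ρ hρ => by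
    rw [hPΦ ρ (hI ρ hρ) _ (hcm01 ρ hρ)]; exact (hcm ρ hρ).2.1
  have hPp : ∀ ρ ∈ Set.Icc (0 : ℝ) (1 - δ), P k m F η ρ (cp ρ) = vhi := fun ρ hρ => by
    rw [hPΦ ρ (hI ρ hρ) _ (hcp01 ρ hρ)]; exact (hcp ρ hρ).2.1
  -- uniqueness of the level points (from the IFT package)
  have huniq_m : ∀ ρ ∈ Set.Icc (0 : ℝ) (1 - δ), ∀ c ∈ Set.Icc (0 : ℝ) 1,
      P k m F η ρ c = vlo → c = cm ρ := fun ρ hρ c hc hPc =>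
    (hcm ρ hρ).2.2 c hc (by rw [← hPΦ ρ (hI ρ hρ) c hc]; exact hPc)
  have huniq_p : ∀ ρ ∈ Set.Icc (0 : ℝ) (1 - δ), ∀ c ∈ Set.Icc (0 : ℝ) 1,
      P k m F η ρ c = vhi → c = cp ρ := fun ρ hρ c hc hPc =>
    (hcp ρ hρ).2.2 c hc (by rw [← hPΦ ρ (hI ρ hρ) c hc]; exact hPc)
  have hlt : ∀ ρ ∈ Set.Icc (0 : ℝ) (1 - δ), cm ρ < cp ρ := by
    intro ρ hρ
    by_contra hle
    rw [not_lt] at hle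
    have := P_mono_c k m F hη0 ρ hle
    rw [hPm ρ hρ, hPp ρ hρ] at this
    linarith
  refine ⟨cm, cp, fun ρ hρ => ⟨hcm01 ρ hρ, hcp01 ρ hρ, hlt ρ hρ, hPm ρ hρ, hPp ρ hρ⟩,
    fun ρ hρ => ?_, fun ρ hρ => ?_, hPOS, fun ρ hρ c hc => ?_⟩
  · refine (hcp' ρ hρ).congr_deriv ?_
    rw [hDρ ρ (hI ρ hρ) _ (hcp01 ρ hρ), hDc ρ (hI ρ hρ) _ (hcp01 ρ hρ)]
  · refine (hcm' ρ hρ).congr_deriv ?_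
    rw [hDρ ρ (hI ρ hρ) _ (hcm01 ρ hρ), hDc ρ (hI ρ hρ) _ (hcm01 ρ hρ)]
  · -- the band at height `ρ` is exactly `[cm ρ, cp ρ]`
    constructor
    · intro hband
      constructor
      · by_contra hlt'
        rw [not_le] at hlt'
        have hle : P k m F η ρ c ≤ vlo := by
          rw [← hPm ρ hρ]; exact P_mono_c k m F hη0 ρ hlt'.le
        have heq : P k m F η ρ c = vlo := le_antisymm hle hband.1
        have := huniq_m ρ hρ c hc heq
        linarith
      · by_contra hlt'
        rw [not_le] at hlt'
        have hge : vhi ≤ P k m F η ρ c := by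
          rw [← hPp ρ hρ]; exact P_mono_c k m F hη0 ρ hlt'.le
        have heq : P k m F η ρ c = vhi := le_antisymm hband.2 hge
        have := huniq_p ρ hρ c hc heq
        linarith
    · rintro ⟨h1c, h2c⟩
      refine ⟨?_, ?_⟩
      · rw [← hPm ρ hρ]; exact P_mono_c k m F hη0 ρ h1c
      · rw [← hPp ρ hρ]; exact P_mono_c k m F hη0 ρ h2c

end Summit.CriticalPhenomena.CardyFormulaZ2.Theorems.CardySelfRefinement

end
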